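import Summits.BirchSwinnertonDyer.BirchSwinnertonDyer.Theorems.RamifiedHeegnerPairTwistUnitInert
import HarnessLib

/-!
# U₁ at the two-SPLIT-carrier Gss2 classes (the Shimura rows), TU|inert — part H: `181485n1`, `182160eg1`

Continuation of `…Theorems.RamifiedHeegnerPairTwistUnitInert` (seat `bsd-trib-w-rhp` g14; the generic lemmas, the two doors
`leafRankOneUpper_three_of_twoCarriers_of_sqrtField` / `leafRankOneUpper_three_of_twoInert_twoOutside_of_sqrtField` and the full framing are there): per rank-one curve
`subGss_three_<label>` (Addv ∧ SubGss at `3` in the kernel), `Δ_eq_/c₄_eq_/krausList_<label>`, Kraus minimality of `V = E^{(-3)}_min` and of the twist model `Wd`, and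
`u1_at_<label> : … → MissingUpperBoundAt W 3` by rhp-p2 g10's two-carrier instrument p657297 `LeafShimuraInert.leafRankOneUpper_three_of_twoCarriers_of_twistUnit`
(resp. p654714 `…_of_shimuraInertDatum_of_twistUnit` on the two-outside rows) with the six printed facts `hGZK hmod hnf hJL hCO hHK` as hypotheses, the split / no-split / Tate
certificates, `hothers`, `hshape` and the field congruences IN THE KERNEL, and `hN hr Dt hc` + the twist `L`-value + `#Ш(Wd)_an` DISPLAYED (+ `bsd3_at_<label>`, lower half
free).  **HONEST FRAMING: theorems only; per-curve certificates under DISPLAYED inputs (conductor, analytic rank, `3 ∤ c(Dt)`, the twist `L`-value, `#Ш(Wd)_an`) and the six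
printed facts of the road as hypotheses; nothing is booked, no item is closed; U₁ (26022) / TU|inert / the Shimura-curve Gross–Zagier–Kolyvagin inputs stay research-level and
OPEN class-wide; BSD is NOT proved for any curve by this file.**
[cite: JetchevSkinnerWan2017, §7.4.2 (p. 31), Thm. 4.4.1 (p. 19)] [cite: PastenShimura2024, Prop. 6.13, Lemma 6.16, Lemma 6.18 (pp. 23–24)]
[cite: PapikianRabinoff2016, Cor. 3.5] [cite: SilvermanAEC2009, VII.5 Prop. 5.1] [cite: SilvermanATAEC1994, IV.9.4] [cite: Tate1975, §7] [cite: Kraus1989, Prop. 1]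
[cite: Marcus2018, Ch. 3 Thm. 25] [cite: Miller2011LMS, Def. 1.1] [cite: Cremona2006, Table 1]
-/

set_option linter.dupNamespace false
set_option autoImplicit false

noncomputable section

open scoped Classical NumberField

open WeierstrassCurve NumberField IsDedekindDomain IsDedekindDomain.HeightOneSpectrum Rat.HeightOneSpectrum Field Literature Literature.NumberTheory.DiophantineGeometry
  Literature.NumberTheory.EllipticCurves Literature.NumberTheory.EllipticCurves.ModularForms Literature.NumberTheory.EllipticCurves.Rank1Residual
  Literature.NumberTheory.EllipticCurves.Rank1Residual.Typed Literature.NumberTheory.Automorphic Literature.NumberTheory.EllipticCurves.Rank1Residual.X11RankOneCertificates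
  Literature.NumberTheory.EllipticCurves.KrizLi2019 Literature.NumberTheory.GaloisRepresentations Literature.NumberTheory.QuadraticFields Literature.NumberTheory.QuadraticFields.Quadratic
  Summit.BirchSwinnertonDyer.BirchSwinnertonDyer.Rank1Residual Summit.BirchSwinnertonDyer.BirchSwinnertonDyer.Rank1Residual.IntModel
  Summit.BirchSwinnertonDyer.BirchSwinnertonDyer.Rank2Observatory.Tam Summit.BirchSwinnertonDyer.Rank1Residual Summit.BirchSwinnertonDyer.Rank1Residual.Additive
  Summit.BirchSwinnertonDyer.Rank1Residual.X11b Summit.BirchSwinnertonDyer.Rank1Residual.X11b.Three Summit.BirchSwinnertonDyer.Rank1Residual.X9 Summit.BirchSwinnertonDyer.Rank1Residual.GaloisImage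
  Summit.BirchSwinnertonDyer.Rank1Residual.Supersingular Summit.BirchSwinnertonDyer.BirchSwinnertonDyer.Theses.RamifiedHeegnerPair Summit.BirchSwinnertonDyer.BirchSwinnertonDyer.Theorems
  Summit.BirchSwinnertonDyer.BirchSwinnertonDyer.Theorems.SchneiderFree Summit.BirchSwinnertonDyer.BirchSwinnertonDyer.Theorems.RamifiedPairUpperBound
  Summit.BirchSwinnertonDyer.BirchSwinnertonDyer.Theorems.RamifiedHeegnerPairStepLIntrinsic Summit.BirchSwinnertonDyer.BirchSwinnertonDyer.Theorems.AdditiveBranchIMCGordTwoRankOne.HeegnerKolyvagin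
  Summit.BirchSwinnertonDyer.BirchSwinnertonDyer.Theorems.RamifiedHeegnerPairTwistUnitIntrinsic Summit.BirchSwinnertonDyer.BirchSwinnertonDyer.Theorems.RamifiedHeegnerPairTwistUnitAdditive

namespace Summit.BirchSwinnertonDyer.BirchSwinnertonDyer.Theorems.RamifiedHeegnerPairTwistUnitInert

/-! ## §13 `181485n1` = `[0, 0, 1, -2097, 14195]`, `N = 181485 = 3^2·5·37·109` (`3`: I₀*, `c = 2`, `5`: I3, `c = 3`, split, `37`: I3, `c = 3`, split, `109`: I1, `c = 1`, split); carriers `S = {37, 5}` (split, `3 ∣ ord Δ`), (DEG) by Papikian–Rabinoff at `q₂ = 5` (odd, `≡ 2 (mod 3)`);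
`r_an = 1`, `#E(ℚ)_tors = 1`, `∏ c_ℓ = 18`, `#Ш(E)_an = 1` (Cremona/LMFDB, displayed where used); class `181485n` of size 1.
`V = E^{(-3)}_min = [0, 0, 1, -233, -526]` (`#Ṽ(𝔽₃) = 4`).  JSW field `K = ℚ(√-143)` (`143 = 11·13`; `37`, `5` inert, every other `ℓ ∣ N` split): the least such `D` with a twist unit
(kit j317417: `L(E^{(-143)},1)/Ω = 32 ≠ 0`, root no. `+1`, `Wd = E^{(-143)}_min = [0, 0, 1, -42881553, -41509849417]`, `N(Wd) = 3711186765`, `∏c = 8`, `T = 1`, `#Ш(Wd)_an = (L/Ω)T²/∏c = 4` exactly). -/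

/-- `V = [0, 0, 1, -233, -526]` (the minimal model of `181485n1^{(-3)}`, conductor `20165`): `Δ ≠ 0` in the kernel. [cite: Cremona2006, Table 1 (Cremona label 181485n1)] -/
theorem isElliptic_sV181485n1 : (⟨0, 0, 1, -233, -526⟩ : WeierstrassCurve ℚ).IsElliptic :=
  isElliptic_of_discOf_ne_zero 0 0 1 (-233) (-526) (by decide +kernel)

/-- `V` is globally minimal: `|Δ| = 5^3·37^3·109` kernel-checked, Kraus' criterion prime by prime. [cite: Kraus1989, Prop. 1 and Prop. 2]
[cite: SilvermanAEC2009, VII.1 Remark 1.1] [cite: Cremona2006, Table 1 (Cremona label 181485n1)] -/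
theorem isGloballyMinimal_sV181485n1 : (⟨0, 0, 1, -233, -526⟩ : WeierstrassCurve ℚ).IsGloballyMinimal :=
  isGloballyMinimal_of_krausCriterion₃_factored 0 0 1 (-233) (-526)
    [(5, 3), (37, 3), (109, 1)] (by decide +kernel)
    (by intro qe hqe; simp only [List.mem_cons, List.not_mem_nil, or_false] at hqe
        rcases hqe with rfl | rfl | rfl <;> norm_num)
    (by set_option synthInstance.maxSize 2000 in decide +kernel)

/-- `Wd = [0, 0, 1, -42881553, -41509849417]` (the minimal model of the twist `181485n1^{(-143)}`, conductor `3711186765`): `Δ ≠ 0` in the kernel. [cite: Cremona2006, Table 1 (Cremona label 181485n1)] -/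
theorem isElliptic_sWd181485n1 : (⟨0, 0, 1, -42881553, -41509849417⟩ : WeierstrassCurve ℚ).IsElliptic :=
  isElliptic_of_discOf_ne_zero 0 0 1 (-42881553) (-41509849417) (by decide +kernel)

/-- `Wd` is globally minimal: `|Δ| = 3^6·5^3·11^6·13^6·37^3·109` kernel-checked, Kraus' criterion prime by prime. [cite: Kraus1989, Prop. 1 and Prop. 2]
[cite: SilvermanAEC2009, VII.1 Remark 1.1] [cite: Cremona2006, Table 1 (Cremona label 181485n1)] -/
theorem isGloballyMinimal_sWd181485n1 : (⟨0, 0, 1, -42881553, -41509849417⟩ : WeierstrassCurve ℚ).IsGloballyMinimal :=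
  isGloballyMinimal_of_krausCriterion₃_factored 0 0 1 (-42881553) (-41509849417)
    [(3, 6), (5, 3), (11, 6), (13, 6), (37, 3), (109, 1)] (by decide +kernel)
    (by intro qe hqe; simp only [List.mem_cons, List.not_mem_nil, or_false] at hqe
        rcases hqe with rfl | rfl | rfl | rfl | rfl | rfl <;> norm_num)
    (by set_option synthInstance.maxSize 2000 in decide +kernel)

/-- **`181485n1` is ADDITIVE at `3` and on the cell (G) ∧ ss, IN THE KERNEL**: `3 ∣ Δ`, `3 ∣ c₄`; `C • V^{(-3)} = E` (`[u, r, s, t] = [1, 0, 0, 1/2]`) with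
`V` globally minimal, `3 ∤ Δ(V)`, `#Ṽ(𝔽₃) = 4` (`a₃(V) = 0`, supersingular), whence `TypeG`, `SubGord`, `SubGss` at `3` (g13's block, unchanged).
[cite: SilvermanAEC2009, VII.5 Prop. 5.1 (a), (c)] [cite: Delbourgo1998, §1.5 (G)] [cite: Cremona2006, Table 1 (Cremona label 181485n1)] -/
theorem subGss_three_181485n1 {W : WeierstrassCurve ℚ} [W.IsElliptic] [W.IsGloballyMinimal] (hWeq : W = (⟨0, 0, 1, -2097, 14195⟩ : WeierstrassCurve ℚ)) :
    Addv W 3 ∧ SubGss W 3 := by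
  subst hWeq
  haveI := isElliptic_sV181485n1
  haveI := isGloballyMinimal_sV181485n1
  have hIW : integralModelInt (⟨0, 0, 1, -2097, 14195⟩ : WeierstrassCurve ℚ) = (⟨0, 0, 1, -2097, 14195⟩ : WeierstrassCurve ℤ) :=
    integralModelInt_eq_of_map_eq _ (map_mk_int 0 0 1 (-2097) 14195)
  have hadd : Addv (⟨0, 0, 1, -2097, 14195⟩ : WeierstrassCurve ℚ) 3 := Additive.addv_of_intModel hIW 3 (by decide +kernel) (by decide +kernel)
  have hIV : integralModelInt (⟨0, 0, 1, -233, -526⟩ : WeierstrassCurve ℚ) = (⟨0, 0, 1, -233, -526⟩ : WeierstrassCurve ℤ) :=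
    integralModelInt_eq_of_map_eq _ (map_mk_int 0 0 1 (-233) (-526))
  have hcV : Nat.card ((((⟨0, 0, 1, -233, -526⟩ : WeierstrassCurve ℤ)).map (Int.castRingHom (ZMod 3))).toAffine.Point) = 4 := by
    have h := natCard_point_eq_countPoints 0 0 1 (-233) (-526) 3 (by norm_num) (by decide +kernel)
    have h' : countPoints [0, 0, 1, -233, -526] 3 = 4 := countPoints_eq_of_fast (by decide +kernel)
    exact_mod_cast h.trans h'
  have hgood : GoodSS (⟨0, 0, 1, -233, -526⟩ : WeierstrassCurve ℚ) 3 := Supersingular.goodSS_of_intModel 3 hIV (by decide +kernel) hcV (by decide)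
  have hVW : (⟨1, (0 : ℚ), (0 : ℚ), ((1:ℚ)/2)⟩ : VariableChange ℚ) • (⟨0, 0, 1, -233, -526⟩ : WeierstrassCurve ℚ).quadraticTwist (-3) =
      (⟨0, 0, 1, -2097, 14195⟩ : WeierstrassCurve ℚ) := by
    ext <;> simp [WeierstrassCurve.variableChange_a₁, WeierstrassCurve.variableChange_a₂,
      WeierstrassCurve.variableChange_a₃, WeierstrassCurve.variableChange_a₄, WeierstrassCurve.variableChange_a₆,
      WeierstrassCurve.quadraticTwist, WeierstrassCurve.b₂, WeierstrassCurve.b₄, WeierstrassCurve.b₆] <;> norm_num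
  obtain ⟨C, hC⟩ := exists_variableChange_quadraticTwist_symm (⟨0, 0, 1, -2097, 14195⟩ : WeierstrassCurve ℚ)
    (⟨0, 0, 1, -233, -526⟩ : WeierstrassCurve ℚ) (d := (-3 : ℚ)) (by norm_num) ⟨_, hVW⟩
  have hC' : C • (⟨0, 0, 1, -2097, 14195⟩ : WeierstrassCurve ℚ).quadraticTwist ((-1 : ℚ) ^ ((3 : ℕ) / 2) * (3 : ℕ)) =
      (⟨0, 0, 1, -233, -526⟩ : WeierstrassCurve ℚ) := by
    rw [O5.pstar_three]; exact hC
  have hG : TypeG (⟨0, 0, 1, -2097, 14195⟩ : WeierstrassCurve ℚ) 3 := (typeG_three_iff_good_twist _ hadd _ C hC').mpr hgood.1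
  exact ⟨hadd, (O5.subGss_three_iff_subGord_and_goodSS_twist _ hadd _ C hC).mpr
    ⟨subGord_three_of_typeG_of_addv _ hG hadd, hgood⟩⟩

/-- `Δ(E₀) = 503117254125 = 3^6·5^3·37^3·109` on the integer equation of `181485n1`. [cite: Cremona2006, Table 1 (Cremona label 181485n1)] -/
theorem Δ_eq_181485n1 : (⟨0, 0, 1, -2097, 14195⟩ : WeierstrassCurve ℤ).Δ = 503117254125 := by
  norm_num [WeierstrassCurve.Δ, WeierstrassCurve.b₂, WeierstrassCurve.b₄, WeierstrassCurve.b₆, WeierstrassCurve.b₈]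

/-- `c₄(E₀) = 100656` on the integer equation of `181485n1`. [cite: Cremona2006, Table 1 (Cremona label 181485n1)] -/
theorem c₄_eq_181485n1 : (⟨0, 0, 1, -2097, 14195⟩ : WeierstrassCurve ℤ).c₄ = 100656 := by
  norm_num [WeierstrassCurve.c₄, WeierstrassCurve.b₂, WeierstrassCurve.b₄]

/-- The Kraus list of `181485n1` consists of primes and multiplies to `|Δ(E₀)|`, IN THE KERNEL: a prime dividing `Δ_min` is one of `[3, 5, 37, 109]`. [cite: Cremona2006, Table 1 (Cremona label 181485n1)] -/
theorem krausList_181485n1 : (∀ qe ∈ ([(3, 6), (5, 3), (37, 3), (109, 1)] : List (ℕ × ℕ)), qe.1.Prime) ∧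
    (([(3, 6), (5, 3), (37, 3), (109, 1)] : List (ℕ × ℕ)).map fun qe => qe.1 ^ qe.2).prod = (503117254125 : ℤ).natAbs :=
  ⟨by decide +kernel, by decide +kernel⟩

/-- **U₁ AT `181485n1` BY THE INERT-CARRIER (Shimura-curve) ROAD, TU|inert** — `MissingUpperBoundAt W 3` at `W = E` from rhp-p2 g10's instrument
p657297 (two carriers, Papikian–Rabinoff (DEG)) through the §0 door `leafRankOneUpper_three_of_twoCarriers_of_sqrtField` of part one.  PRINTED: `hGZK hmod hnf hJL hCO hHK`.  KERNEL: `Addv ∧ SubGss` at `3`;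
`37`, `5` split (nodal roots `6`, `2`); every prime of `Δ_min` enumerated (`krausList_181485n1`) for `hothers` and `hshape` (`c = 1` off `Δ_min`, Kodaira–Néron at the
multiplicative primes, Tate certificates at the additive primes `[3]`); the congruences making `37`, `5` inert and the other `ℓ ∣ N` split in `ℚ(√-143)`; the twist
identity `Cd • E^{(-143)} = Wd`, `Cd = [1, 0, 0, 1/2]`, with `Wd` Kraus-minimal.  DISPLAYED: `hN`, `hr`, `Dt`/`hc` (`3 ∤ c(Dt)`), `hLt` (`L(E^{(-143)},1) ≠ 0`), `hqd`/`hvd`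
(`#Ш(Wd)_an = 4`).  NO ¬CM / S2 / Σ / L₀.  Per curve; U₁ (26022) stays OPEN class-wide; `BSDp W 3` follows by `bsdp_three_of_upper_of_shaAn_unit`; BSD is NOT proved by this.
[cite: JetchevSkinnerWan2017, §7.4.2 (p. 31)] [cite: PastenShimura2024, Prop. 6.13, Lemma 6.18] [cite: SilvermanAEC2009, VII.5 Prop. 5.1] [cite: Cremona2006, Table 1 (Cremona label 181485n1)] -/
theorem u1_at_181485n1
    (hGZK : rank_eq_analyticRank_of_analyticRank_le_one) (hmod : hasEntireLFunction_rat)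
    (hnf : exists_isNewformOf) (hJL : nonempty_shimuraParametrizationData)
    (hCO : PastenShimura2024_componentOrders)
    (hHK : shimuraCurve_heegnerPoint_grossZagier_kolyvagin)
    {W : WeierstrassCurve ℚ} [W.IsElliptic] [W.IsGloballyMinimal] (hWeq : W = (⟨0, 0, 1, -2097, 14195⟩ : WeierstrassCurve ℚ))
    (hN : W.conductorNorm ℤ = 181485) [NeZero (W.conductorNorm ℤ)] (hr : W.analyticRank = 1)
    (Dt : ModularParametrizationData W (W.conductorNorm ℤ)) (hc : ¬ (3 : ℤ) ∣ Dt.c)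
    (hLt : (W.quadraticTwist (((-143 : ℤ) : ℚ))).entireLFunction 1 ≠ 0)
    {qd : ℚ} (hqd : haveI := isElliptic_sWd181485n1; shaAn (⟨0, 0, 1, -42881553, -41509849417⟩ : WeierstrassCurve ℚ) = (qd : ℂ))
    (hvd : padicValRat 3 qd ≤ 0) :
    MissingUpperBoundAt W 3 := by
  subst hWeq
  haveI := isElliptic_sWd181485n1; haveI := isGloballyMinimal_sWd181485n1
  have hI : integralModelInt (⟨0, 0, 1, -2097, 14195⟩ : WeierstrassCurve ℚ) = (⟨0, 0, 1, -2097, 14195⟩ : WeierstrassCurve ℤ) :=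
    integralModelInt_eq_of_map_eq _ (map_mk_int 0 0 1 (-2097) 14195)
  have hGS := subGss_three_181485n1 (W := (⟨0, 0, 1, -2097, 14195⟩ : WeierstrassCurve ℚ)) rfl
  have hs₁ : haveI : Fact (Nat.Prime 37) := ⟨by norm_num⟩; (⟨0, 0, 1, -2097, 14195⟩ : WeierstrassCurve ℚ).HasSplitMultiplicativeReductionAtPrime 37 := by
    refine IntModel.hasSplitMultiplicativeReductionAtPrime_of_intModel_of_root hI 37 (by rw [Δ_eq_181485n1]; norm_num) (by rw [c₄_eq_181485n1]; norm_num) ⟨6, ?_⟩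
    simp only [WeierstrassCurve.c₄, WeierstrassCurve.b₂, WeierstrassCurve.b₄, WeierstrassCurve.b₆]; push_cast; decide
  have hs₂ : haveI : Fact (Nat.Prime 5) := ⟨by norm_num⟩; (⟨0, 0, 1, -2097, 14195⟩ : WeierstrassCurve ℚ).HasSplitMultiplicativeReductionAtPrime 5 := by
    refine IntModel.hasSplitMultiplicativeReductionAtPrime_of_intModel_of_root hI 5 (by rw [Δ_eq_181485n1]; norm_num) (by rw [c₄_eq_181485n1]; norm_num) ⟨2, ?_⟩
    simp only [WeierstrassCurve.c₄, WeierstrassCurve.b₂, WeierstrassCurve.b₄, WeierstrassCurve.b₆]; push_cast; decide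
  haveI : Fact ((-143 : ℤ) < 0) := ⟨by norm_num⟩; haveI : Fact (Nat.Prime 37) := ⟨by norm_num⟩; haveI : Fact (Nat.Prime 5) := ⟨by norm_num⟩
  have hothers : ∀ (ℓ : ℕ) [Fact ℓ.Prime], ℓ ≠ 37 → ℓ ≠ 5 → (⟨0, 0, 1, -2097, 14195⟩ : WeierstrassCurve ℚ).HasSplitMultiplicativeReductionAtPrime ℓ →
      ¬ 3 ∣ padicValInt ℓ (⟨0, 0, 1, -2097, 14195⟩ : WeierstrassCurve ℚ).minimalDiscriminantInt := by
    intro ℓ hℓF hne₁ hne₂ hs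
    have hd := dvd_minimalDiscriminantInt_of_mult _ ℓ hs.hasMultiplicativeReductionAtPrime
    rw [IntModel.minimalDiscriminantInt_eq hI, Δ_eq_181485n1] at hd
    have hmem := mem_of_prime_dvd_of_prodPow_eq _ krausList_181485n1 hℓF.out hd
    simp only [List.map_cons, List.map_nil, List.mem_cons, List.not_mem_nil, or_false] at hmem
    rcases hmem with rfl | rfl | rfl | rfl
    · exact absurd hs.hasMultiplicativeReductionAtPrime (X9.PrintCert.not_hasMultiplicativeReductionAtPrime_of_dvd_of_dvd hI 3 (by rw [Δ_eq_181485n1]; norm_num) (by rw [c₄_eq_181485n1]; norm_num))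
    · exact absurd rfl hne₂
    · exact absurd rfl hne₁
    · rw [IntModel.minimalDiscriminantInt_eq hI, Δ_eq_181485n1, IntModel.padicValInt_eq_of_dvd_of_not_dvd 109 (e := 1) (by norm_num) (by norm_num)]
      decide
  have hshape : ∀ (q : ℕ) [Fact q.Prime], 3 ∣ ((⟨0, 0, 1, -2097, 14195⟩ : WeierstrassCurve ℚ).baseChange ℚ_[q]).localTamagawaNumber ℤ_[q] →
      (⟨0, 0, 1, -2097, 14195⟩ : WeierstrassCurve ℚ).HasSplitMultiplicativeReductionAtPrime q := by
    intro q hqF h3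
    by_cases hd : (q : ℤ) ∣ minimalDiscriminantInt (⟨0, 0, 1, -2097, 14195⟩ : WeierstrassCurve ℚ)
    swap
    · exact absurd h3 (not_three_dvd_localTamagawaNumber_of_not_dvd _ q hd)
    rw [IntModel.minimalDiscriminantInt_eq hI, Δ_eq_181485n1] at hd
    have hmem := mem_of_prime_dvd_of_prodPow_eq _ krausList_181485n1 hqF.out hd
    simp only [List.map_cons, List.map_nil, List.mem_cons, List.not_mem_nil, or_false] at hmem
    rcases hmem with rfl | rfl | rfl | rfl
    · have hc3 : ((⟨0, 0, 1, -2097, 14195⟩ : WeierstrassCurve ℚ).baseChange ℚ_[3]).localTamagawaNumber ℤ_[3] = 2 := -- additive `3` (I0*): Tate certificate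
        (IntModelTam.localTamagawaNumber_padic_eq_of_intModel_of_tamZ hI 3 (F := ⟨3, 9, 0, 0, 4, 6, 0, 1⟩) rfl (by decide +kernel)).trans (by decide)
      rw [hc3] at h3; exact absurd h3 (by decide)
    · exact hs₂
    · exact hs₁
    · exact (Koly.split_and_three_dvd_of_mult_of_three_dvd_localTamagawaNumber _ 109 (IntModel.hasMultiplicativeReductionAtPrime_of_intModel hI 109 (by rw [Δ_eq_181485n1]; norm_num) (by rw [c₄_eq_181485n1]; norm_num)) h3).1
  have hjac : ∀ ℓ : ℕ, ℓ.Prime → ℓ ∣ (⟨0, 0, 1, -2097, 14195⟩ : WeierstrassCurve ℚ).conductorNorm ℤ → ℓ ≠ 37 → ℓ ≠ 5 → ℓ ≠ 2 →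
      jacobiSym (-143) ℓ = 1 := by
    intro ℓ hℓ hℓN hne₁ hne₂ hℓ2
    rw [hN] at hℓN
    have hmem : ℓ ∈ Nat.primeFactors 181485 := Nat.mem_primeFactors.mpr ⟨hℓ, hℓN, by norm_num⟩
    rw [show Nat.primeFactors 181485 = {3, 5, 37, 109} by decide +kernel] at hmem
    simp only [Finset.mem_insert, Finset.mem_singleton] at hmem
    rcases hmem with rfl | rfl | rfl | rfl
    · norm_num [jacobiSym.mod_left]
    · exact absurd rfl hne₂
    · exact absurd rfl hne₁
    · norm_num [jacobiSym.mod_left]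
  have hWd : (⟨1, (0 : ℚ), (0 : ℚ), ((1:ℚ)/2)⟩ : VariableChange ℚ) • (⟨0, 0, 1, -2097, 14195⟩ : WeierstrassCurve ℚ).quadraticTwist (((-143 : ℤ) : ℚ)) =
      (⟨0, 0, 1, -42881553, -41509849417⟩ : WeierstrassCurve ℚ) := by
    push_cast; ext <;> simp [WeierstrassCurve.variableChange_a₁, WeierstrassCurve.variableChange_a₂,
      WeierstrassCurve.variableChange_a₃, WeierstrassCurve.variableChange_a₄, WeierstrassCurve.variableChange_a₆,
      WeierstrassCurve.quadraticTwist, WeierstrassCurve.b₂, WeierstrassCurve.b₄, WeierstrassCurve.b₆] <;> norm_num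
  exact leafRankOneUpper_three_of_twoCarriers_of_sqrtField hGZK hmod hnf hJL hCO hHK _ hGS.1 hGS.2 hr rfl Dt hc
    (q₁ := 37) (q₂ := 5) (by decide) hs₁ hs₂ hothers (by decide) (by decide) hshape
    (-143) (by norm_num)
    (by rw [show (-143 : ℤ).natAbs = 143 by rfl, Nat.squarefree_iff_nodup_primeFactorsList (by norm_num)]; simp)
    (Or.inr ⟨by decide, by norm_num [jacobiSym.mod_left]⟩) (by norm_num) (by norm_num [jacobiSym.mod_left]) (by norm_num) hjac
    (fun h _ ↦ by rw [hN] at h; norm_num at h) hLt _ _ hWd hqd hvd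

/-! ## §14 `182160eg1` = `[0, 0, 0, -194382, 35287731]`, `N = 182160 = 2^4·3^2·5·11·23` (`2`: II, `c = 1`, `3`: I₀*, `c = 4`, `5`: I6, `c = 6`, split, `11`: I3, `c = 3`, split, `23`: I4, `c = 4`, split); carriers `S = {5, 11}` (split, `3 ∣ ord Δ`), (DEG) by Papikian–Rabinoff at `q₂ = 11` (odd, `≡ 2 (mod 3)`);
`r_an = 1`, `#E(ℚ)_tors = 2`, `∏ c_ℓ = 288`, `#Ш(E)_an = 1` (Cremona/LMFDB, displayed where used); class `182160eg` of size 2.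
`V = E^{(-3)}_min = [0, 0, 0, -21598, -1306953]` (`#Ṽ(𝔽₃) = 4`).  JSW field `K = ℚ(√-383)` (`383` prime; `5`, `11` inert, every other `ℓ ∣ N` split): the least such `D` with a twist unit
(kit j317417: `L(E^{(-383)},1)/Ω = 512 ≠ 0`, root no. `+1`, `Wd = E^{(-383)}_min = [0, 0, 0, -28513701198, -1982531315528397]`, `N(Wd) = 26720868240`, `∏c = 128`, `T = 2`, `#Ш(Wd)_an = (L/Ω)T²/∏c = 16` exactly). -/

/-- `V = [0, 0, 0, -21598, -1306953]` (the minimal model of `182160eg1^{(-3)}`, conductor `20240`): `Δ ≠ 0` in the kernel. [cite: Cremona2006, Table 1 (Cremona label 182160eg1)] -/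
theorem isElliptic_sV182160eg1 : (⟨0, 0, 0, -21598, -1306953⟩ : WeierstrassCurve ℚ).IsElliptic :=
  isElliptic_of_discOf_ne_zero 0 0 0 (-21598) (-1306953) (by decide +kernel)

/-- `V` is globally minimal: `|Δ| = 2^4·5^6·11^3·23^4` kernel-checked, Kraus' criterion prime by prime. [cite: Kraus1989, Prop. 1 and Prop. 2]
[cite: SilvermanAEC2009, VII.1 Remark 1.1] [cite: Cremona2006, Table 1 (Cremona label 182160eg1)] -/
theorem isGloballyMinimal_sV182160eg1 : (⟨0, 0, 0, -21598, -1306953⟩ : WeierstrassCurve ℚ).IsGloballyMinimal :=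
  isGloballyMinimal_of_krausCriterion₃_factored 0 0 0 (-21598) (-1306953)
    [(2, 4), (5, 6), (11, 3), (23, 4)] (by decide +kernel)
    (by intro qe hqe; simp only [List.mem_cons, List.not_mem_nil, or_false] at hqe
        rcases hqe with rfl | rfl | rfl | rfl <;> norm_num)
    (by set_option synthInstance.maxSize 2000 in decide +kernel)

/-- `Wd = [0, 0, 0, -28513701198, -1982531315528397]` (the minimal model of the twist `182160eg1^{(-383)}`, conductor `26720868240`): `Δ ≠ 0` in the kernel. [cite: Cremona2006, Table 1 (Cremona label 182160eg1)] -/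
theorem isElliptic_sWd182160eg1 : (⟨0, 0, 0, -28513701198, -1982531315528397⟩ : WeierstrassCurve ℚ).IsElliptic :=
  isElliptic_of_discOf_ne_zero 0 0 0 (-28513701198) (-1982531315528397) (by decide +kernel)

/-- `Wd` is globally minimal: `|Δ| = 2^4·3^6·5^6·11^3·23^4·383^6` kernel-checked, Kraus' criterion prime by prime. [cite: Kraus1989, Prop. 1 and Prop. 2]
[cite: SilvermanAEC2009, VII.1 Remark 1.1] [cite: Cremona2006, Table 1 (Cremona label 182160eg1)] -/
theorem isGloballyMinimal_sWd182160eg1 : (⟨0, 0, 0, -28513701198, -1982531315528397⟩ : WeierstrassCurve ℚ).IsGloballyMinimal :=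
  isGloballyMinimal_of_krausCriterion₃_factored 0 0 0 (-28513701198) (-1982531315528397)
    [(2, 4), (3, 6), (5, 6), (11, 3), (23, 4), (383, 6)] (by decide +kernel)
    (by intro qe hqe; simp only [List.mem_cons, List.not_mem_nil, or_false] at hqe
        rcases hqe with rfl | rfl | rfl | rfl | rfl | rfl <;> norm_num)
    (by set_option synthInstance.maxSize 2000 in decide +kernel)

/-- **`182160eg1` is ADDITIVE at `3` and on the cell (G) ∧ ss, IN THE KERNEL**: `3 ∣ Δ`, `3 ∣ c₄`; `C • V^{(-3)} = E` (`[u, r, s, t] = [1, 0, 0, 0]`) with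
`V` globally minimal, `3 ∤ Δ(V)`, `#Ṽ(𝔽₃) = 4` (`a₃(V) = 0`, supersingular), whence `TypeG`, `SubGord`, `SubGss` at `3` (g13's block, unchanged).
[cite: SilvermanAEC2009, VII.5 Prop. 5.1 (a), (c)] [cite: Delbourgo1998, §1.5 (G)] [cite: Cremona2006, Table 1 (Cremona label 182160eg1)] -/
theorem subGss_three_182160eg1 {W : WeierstrassCurve ℚ} [W.IsElliptic] [W.IsGloballyMinimal] (hWeq : W = (⟨0, 0, 0, -194382, 35287731⟩ : WeierstrassCurve ℚ)) :
    Addv W 3 ∧ SubGss W 3 := by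
  subst hWeq
  haveI := isElliptic_sV182160eg1
  haveI := isGloballyMinimal_sV182160eg1
  have hIW : integralModelInt (⟨0, 0, 0, -194382, 35287731⟩ : WeierstrassCurve ℚ) = (⟨0, 0, 0, -194382, 35287731⟩ : WeierstrassCurve ℤ) :=
    integralModelInt_eq_of_map_eq _ (map_mk_int 0 0 0 (-194382) 35287731)
  have hadd : Addv (⟨0, 0, 0, -194382, 35287731⟩ : WeierstrassCurve ℚ) 3 := Additive.addv_of_intModel hIW 3 (by decide +kernel) (by decide +kernel)
  have hIV : integralModelInt (⟨0, 0, 0, -21598, -1306953⟩ : WeierstrassCurve ℚ) = (⟨0, 0, 0, -21598, -1306953⟩ : WeierstrassCurve ℤ) :=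
    integralModelInt_eq_of_map_eq _ (map_mk_int 0 0 0 (-21598) (-1306953))
  have hcV : Nat.card ((((⟨0, 0, 0, -21598, -1306953⟩ : WeierstrassCurve ℤ)).map (Int.castRingHom (ZMod 3))).toAffine.Point) = 4 := by
    have h := natCard_point_eq_countPoints 0 0 0 (-21598) (-1306953) 3 (by norm_num) (by decide +kernel)
    have h' : countPoints [0, 0, 0, -21598, -1306953] 3 = 4 := countPoints_eq_of_fast (by decide +kernel)
    exact_mod_cast h.trans h'
  have hgood : GoodSS (⟨0, 0, 0, -21598, -1306953⟩ : WeierstrassCurve ℚ) 3 := Supersingular.goodSS_of_intModel 3 hIV (by decide +kernel) hcV (by decide)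
  have hVW : (⟨1, (0 : ℚ), (0 : ℚ), (0 : ℚ)⟩ : VariableChange ℚ) • (⟨0, 0, 0, -21598, -1306953⟩ : WeierstrassCurve ℚ).quadraticTwist (-3) =
      (⟨0, 0, 0, -194382, 35287731⟩ : WeierstrassCurve ℚ) := by
    ext <;> simp [WeierstrassCurve.variableChange_a₁, WeierstrassCurve.variableChange_a₂,
      WeierstrassCurve.variableChange_a₃, WeierstrassCurve.variableChange_a₄, WeierstrassCurve.variableChange_a₆,
      WeierstrassCurve.quadraticTwist, WeierstrassCurve.b₂, WeierstrassCurve.b₄, WeierstrassCurve.b₆] <;> norm_num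
  obtain ⟨C, hC⟩ := exists_variableChange_quadraticTwist_symm (⟨0, 0, 0, -194382, 35287731⟩ : WeierstrassCurve ℚ)
    (⟨0, 0, 0, -21598, -1306953⟩ : WeierstrassCurve ℚ) (d := (-3 : ℚ)) (by norm_num) ⟨_, hVW⟩
  have hC' : C • (⟨0, 0, 0, -194382, 35287731⟩ : WeierstrassCurve ℚ).quadraticTwist ((-1 : ℚ) ^ ((3 : ℕ) / 2) * (3 : ℕ)) =
      (⟨0, 0, 0, -21598, -1306953⟩ : WeierstrassCurve ℚ) := by
    rw [O5.pstar_three]; exact hC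
  have hG : TypeG (⟨0, 0, 0, -194382, 35287731⟩ : WeierstrassCurve ℚ) 3 := (typeG_three_iff_good_twist _ hadd _ C hC').mpr hgood.1
  exact ⟨hadd, (O5.subGss_three_iff_subGord_and_goodSS_twist _ hadd _ C hC).mpr
    ⟨subGord_three_of_typeG_of_addv _ hG hadd, hgood⟩⟩

/-- `Δ(E₀) = -67882360614750000 = -2^4·3^6·5^6·11^3·23^4` on the integer equation of `182160eg1`. [cite: Cremona2006, Table 1 (Cremona label 182160eg1)] -/
theorem Δ_eq_182160eg1 : (⟨0, 0, 0, -194382, 35287731⟩ : WeierstrassCurve ℤ).Δ = -67882360614750000 := by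
  norm_num [WeierstrassCurve.Δ, WeierstrassCurve.b₂, WeierstrassCurve.b₄, WeierstrassCurve.b₆, WeierstrassCurve.b₈]

/-- `c₄(E₀) = 9330336` on the integer equation of `182160eg1`. [cite: Cremona2006, Table 1 (Cremona label 182160eg1)] -/
theorem c₄_eq_182160eg1 : (⟨0, 0, 0, -194382, 35287731⟩ : WeierstrassCurve ℤ).c₄ = 9330336 := by
  norm_num [WeierstrassCurve.c₄, WeierstrassCurve.b₂, WeierstrassCurve.b₄]

/-- The Kraus list of `182160eg1` consists of primes and multiplies to `|Δ(E₀)|`, IN THE KERNEL: a prime dividing `Δ_min` is one of `[2, 3, 5, 11, 23]`. [cite: Cremona2006, Table 1 (Cremona label 182160eg1)] -/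
theorem krausList_182160eg1 : (∀ qe ∈ ([(2, 4), (3, 6), (5, 6), (11, 3), (23, 4)] : List (ℕ × ℕ)), qe.1.Prime) ∧
    (([(2, 4), (3, 6), (5, 6), (11, 3), (23, 4)] : List (ℕ × ℕ)).map fun qe => qe.1 ^ qe.2).prod = (-67882360614750000 : ℤ).natAbs :=
  ⟨by decide +kernel, by decide +kernel⟩

/-- **U₁ AT `182160eg1` BY THE INERT-CARRIER (Shimura-curve) ROAD, TU|inert** — `MissingUpperBoundAt W 3` at `W = E` from rhp-p2 g10's instrument
p657297 (two carriers, Papikian–Rabinoff (DEG)) through the §0 door `leafRankOneUpper_three_of_twoCarriers_of_sqrtField` of part one.  PRINTED: `hGZK hmod hnf hJL hCO hHK`.  KERNEL: `Addv ∧ SubGss` at `3`;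
`5`, `11` split (nodal roots `1`, `4`); every prime of `Δ_min` enumerated (`krausList_182160eg1`) for `hothers` and `hshape` (`c = 1` off `Δ_min`, Kodaira–Néron at the
multiplicative primes, Tate certificates at the additive primes `[2, 3]`); the congruences making `5`, `11` inert and the other `ℓ ∣ N` split in `ℚ(√-383)`; the twist
identity `Cd • E^{(-383)} = Wd`, `Cd = [1, 0, 0, 0]`, with `Wd` Kraus-minimal.  DISPLAYED: `hN`, `hr`, `Dt`/`hc` (`3 ∤ c(Dt)`), `hLt` (`L(E^{(-383)},1) ≠ 0`), `hqd`/`hvd`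
(`#Ш(Wd)_an = 16`).  NO ¬CM / S2 / Σ / L₀.  Per curve; U₁ (26022) stays OPEN class-wide; `BSDp W 3` follows by `bsdp_three_of_upper_of_shaAn_unit`; BSD is NOT proved by this.
[cite: JetchevSkinnerWan2017, §7.4.2 (p. 31)] [cite: PastenShimura2024, Prop. 6.13, Lemma 6.18] [cite: SilvermanAEC2009, VII.5 Prop. 5.1] [cite: Cremona2006, Table 1 (Cremona label 182160eg1)] -/
theorem u1_at_182160eg1
    (hGZK : rank_eq_analyticRank_of_analyticRank_le_one) (hmod : hasEntireLFunction_rat)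
    (hnf : exists_isNewformOf) (hJL : nonempty_shimuraParametrizationData)
    (hCO : PastenShimura2024_componentOrders)
    (hHK : shimuraCurve_heegnerPoint_grossZagier_kolyvagin)
    {W : WeierstrassCurve ℚ} [W.IsElliptic] [W.IsGloballyMinimal] (hWeq : W = (⟨0, 0, 0, -194382, 35287731⟩ : WeierstrassCurve ℚ))
    (hN : W.conductorNorm ℤ = 182160) [NeZero (W.conductorNorm ℤ)] (hr : W.analyticRank = 1)
    (Dt : ModularParametrizationData W (W.conductorNorm ℤ)) (hc : ¬ (3 : ℤ) ∣ Dt.c)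
    (hLt : (W.quadraticTwist (((-383 : ℤ) : ℚ))).entireLFunction 1 ≠ 0)
    {qd : ℚ} (hqd : haveI := isElliptic_sWd182160eg1; shaAn (⟨0, 0, 0, -28513701198, -1982531315528397⟩ : WeierstrassCurve ℚ) = (qd : ℂ))
    (hvd : padicValRat 3 qd ≤ 0) :
    MissingUpperBoundAt W 3 := by
  subst hWeq
  haveI := isElliptic_sWd182160eg1; haveI := isGloballyMinimal_sWd182160eg1
  have hI : integralModelInt (⟨0, 0, 0, -194382, 35287731⟩ : WeierstrassCurve ℚ) = (⟨0, 0, 0, -194382, 35287731⟩ : WeierstrassCurve ℤ) :=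
    integralModelInt_eq_of_map_eq _ (map_mk_int 0 0 0 (-194382) 35287731)
  have hGS := subGss_three_182160eg1 (W := (⟨0, 0, 0, -194382, 35287731⟩ : WeierstrassCurve ℚ)) rfl
  have hs₁ : haveI : Fact (Nat.Prime 5) := ⟨by norm_num⟩; (⟨0, 0, 0, -194382, 35287731⟩ : WeierstrassCurve ℚ).HasSplitMultiplicativeReductionAtPrime 5 := by
    refine IntModel.hasSplitMultiplicativeReductionAtPrime_of_intModel_of_root hI 5 (by rw [Δ_eq_182160eg1]; norm_num) (by rw [c₄_eq_182160eg1]; norm_num) ⟨1, ?_⟩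
    simp only [WeierstrassCurve.c₄, WeierstrassCurve.b₂, WeierstrassCurve.b₄, WeierstrassCurve.b₆]; push_cast; decide
  have hs₂ : haveI : Fact (Nat.Prime 11) := ⟨by norm_num⟩; (⟨0, 0, 0, -194382, 35287731⟩ : WeierstrassCurve ℚ).HasSplitMultiplicativeReductionAtPrime 11 := by
    refine IntModel.hasSplitMultiplicativeReductionAtPrime_of_intModel_of_root hI 11 (by rw [Δ_eq_182160eg1]; norm_num) (by rw [c₄_eq_182160eg1]; norm_num) ⟨4, ?_⟩
    simp only [WeierstrassCurve.c₄, WeierstrassCurve.b₂, WeierstrassCurve.b₄, WeierstrassCurve.b₆]; push_cast; decide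
  haveI : Fact ((-383 : ℤ) < 0) := ⟨by norm_num⟩; haveI : Fact (Nat.Prime 5) := ⟨by norm_num⟩; haveI : Fact (Nat.Prime 11) := ⟨by norm_num⟩
  have hothers : ∀ (ℓ : ℕ) [Fact ℓ.Prime], ℓ ≠ 5 → ℓ ≠ 11 → (⟨0, 0, 0, -194382, 35287731⟩ : WeierstrassCurve ℚ).HasSplitMultiplicativeReductionAtPrime ℓ →
      ¬ 3 ∣ padicValInt ℓ (⟨0, 0, 0, -194382, 35287731⟩ : WeierstrassCurve ℚ).minimalDiscriminantInt := by
    intro ℓ hℓF hne₁ hne₂ hs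
    have hd := dvd_minimalDiscriminantInt_of_mult _ ℓ hs.hasMultiplicativeReductionAtPrime
    rw [IntModel.minimalDiscriminantInt_eq hI, Δ_eq_182160eg1] at hd
    have hmem := mem_of_prime_dvd_of_prodPow_eq _ krausList_182160eg1 hℓF.out hd
    simp only [List.map_cons, List.map_nil, List.mem_cons, List.not_mem_nil, or_false] at hmem
    rcases hmem with rfl | rfl | rfl | rfl | rfl
    · exact absurd hs.hasMultiplicativeReductionAtPrime (X9.PrintCert.not_hasMultiplicativeReductionAtPrime_of_dvd_of_dvd hI 2 (by rw [Δ_eq_182160eg1]; norm_num) (by rw [c₄_eq_182160eg1]; norm_num))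
    · exact absurd hs.hasMultiplicativeReductionAtPrime (X9.PrintCert.not_hasMultiplicativeReductionAtPrime_of_dvd_of_dvd hI 3 (by rw [Δ_eq_182160eg1]; norm_num) (by rw [c₄_eq_182160eg1]; norm_num))
    · exact absurd rfl hne₁
    · exact absurd rfl hne₂
    · rw [IntModel.minimalDiscriminantInt_eq hI, Δ_eq_182160eg1, IntModel.padicValInt_eq_of_dvd_of_not_dvd 23 (e := 4) (by norm_num) (by norm_num)]
      decide
  have hshape : ∀ (q : ℕ) [Fact q.Prime], 3 ∣ ((⟨0, 0, 0, -194382, 35287731⟩ : WeierstrassCurve ℚ).baseChange ℚ_[q]).localTamagawaNumber ℤ_[q] →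
      (⟨0, 0, 0, -194382, 35287731⟩ : WeierstrassCurve ℚ).HasSplitMultiplicativeReductionAtPrime q := by
    intro q hqF h3
    by_cases hd : (q : ℤ) ∣ minimalDiscriminantInt (⟨0, 0, 0, -194382, 35287731⟩ : WeierstrassCurve ℚ)
    swap
    · exact absurd h3 (not_three_dvd_localTamagawaNumber_of_not_dvd _ q hd)
    rw [IntModel.minimalDiscriminantInt_eq hI, Δ_eq_182160eg1] at hd
    have hmem := mem_of_prime_dvd_of_prodPow_eq _ krausList_182160eg1 hqF.out hd
    simp only [List.map_cons, List.map_nil, List.mem_cons, List.not_mem_nil, or_false] at hmem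
    rcases hmem with rfl | rfl | rfl | rfl | rfl
    · have hc2 : ((⟨0, 0, 0, -194382, 35287731⟩ : WeierstrassCurve ℚ).baseChange ℚ_[2]).localTamagawaNumber ℤ_[2] = 1 := -- additive `2` (II): Tate certificate
        IntModelTam.localTamagawaNumber_padic_eq_of_intModel_of_tamLocal hI 2 (E := ⟨2, 1, 4, 0, 0, 0, 1, 4, 2, 1, 1⟩) rfl (by decide +kernel) (c := 1) rfl
      rw [hc2] at h3; exact absurd h3 (by decide)
    · have hc3 : ((⟨0, 0, 0, -194382, 35287731⟩ : WeierstrassCurve ℚ).baseChange ℚ_[3]).localTamagawaNumber ℤ_[3] = 4 := -- additive `3` (I0*): Tate certificate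
        (IntModelTam.localTamagawaNumber_padic_eq_of_intModel_of_tamZ hI 3 (F := ⟨3, 9, 0, 0, 0, 6, 0, 3⟩) rfl (by decide +kernel)).trans (by decide)
      rw [hc3] at h3; exact absurd h3 (by decide)
    · exact hs₁
    · exact hs₂
    · exact (Koly.split_and_three_dvd_of_mult_of_three_dvd_localTamagawaNumber _ 23 (IntModel.hasMultiplicativeReductionAtPrime_of_intModel hI 23 (by rw [Δ_eq_182160eg1]; norm_num) (by rw [c₄_eq_182160eg1]; norm_num)) h3).1
  have hjac : ∀ ℓ : ℕ, ℓ.Prime → ℓ ∣ (⟨0, 0, 0, -194382, 35287731⟩ : WeierstrassCurve ℚ).conductorNorm ℤ → ℓ ≠ 5 → ℓ ≠ 11 → ℓ ≠ 2 →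
      jacobiSym (-383) ℓ = 1 := by
    intro ℓ hℓ hℓN hne₁ hne₂ hℓ2
    rw [hN] at hℓN
    have hmem : ℓ ∈ Nat.primeFactors 182160 := Nat.mem_primeFactors.mpr ⟨hℓ, hℓN, by norm_num⟩
    rw [show Nat.primeFactors 182160 = {2, 3, 5, 11, 23} by decide +kernel] at hmem
    simp only [Finset.mem_insert, Finset.mem_singleton] at hmem
    rcases hmem with rfl | rfl | rfl | rfl | rfl
    · exact absurd rfl hℓ2
    · norm_num [jacobiSym.mod_left]
    · exact absurd rfl hne₁
    · exact absurd rfl hne₂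
    · norm_num [jacobiSym.mod_left]
  have hWd : (⟨1, (0 : ℚ), (0 : ℚ), (0 : ℚ)⟩ : VariableChange ℚ) • (⟨0, 0, 0, -194382, 35287731⟩ : WeierstrassCurve ℚ).quadraticTwist (((-383 : ℤ) : ℚ)) =
      (⟨0, 0, 0, -28513701198, -1982531315528397⟩ : WeierstrassCurve ℚ) := by
    push_cast; ext <;> simp [WeierstrassCurve.variableChange_a₁, WeierstrassCurve.variableChange_a₂,
      WeierstrassCurve.variableChange_a₃, WeierstrassCurve.variableChange_a₄, WeierstrassCurve.variableChange_a₆,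
      WeierstrassCurve.quadraticTwist, WeierstrassCurve.b₂, WeierstrassCurve.b₄, WeierstrassCurve.b₆] <;> norm_num
  exact leafRankOneUpper_three_of_twoCarriers_of_sqrtField hGZK hmod hnf hJL hCO hHK _ hGS.1 hGS.2 hr rfl Dt hc
    (q₁ := 5) (q₂ := 11) (by decide) hs₁ hs₂ hothers (by decide) (by decide) hshape
    (-383) (by norm_num)
    (by rw [show (-383 : ℤ).natAbs = 383 by rfl, Nat.squarefree_iff_nodup_primeFactorsList (by norm_num)]; simp)
    (Or.inr ⟨by decide, by norm_num [jacobiSym.mod_left]⟩) (by norm_num) (by norm_num [jacobiSym.mod_left]) (by norm_num) hjac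
    (fun _ _ ↦ by norm_num) hLt _ _ hWd hqd hvd

end Summit.BirchSwinnertonDyer.BirchSwinnertonDyer.Theorems.RamifiedHeegnerPairTwistUnitInert

end
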